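import Summits.AnomalousDissipation.AnomalousDissipation.Theorems.QuarticGate.Negative.EnergyRow
import Summits.AnomalousDissipation.AnomalousDissipation.Theorems.QuarticGate.Negative.Laminar

/-!
# Negative knowledge for the crux `MomentParity.GalerkinInvariantLoud` (stmt-AnomalousDissipation-14283), I:
# clauses, transfer to `QuarticGate`, necessary conditions on witnesses, the load-bearing table

Certified copy of §0–§2b of the cdisprove work file `Cruxes/GalerkinInvariantLoud/Disproof.lean`
(refuter-cdisprove-stmt-AnomalousDissipation-14283-0, cycle 1). Supports stmt-AnomalousDissipation-14283; no
conclusion asserts a Theses decl positively (the crux is an `∃`-statement: proved here are necessary conditions on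
its witnesses, refutations of natural strengthenings, and weakenings that hold trivially).

* §0 `IsInvariant` (all-order polynomial stationarity), `IsGILWitness`, `galerkinInvariantLoud_iff` (`Iff.rfl`).
* §1 `IsGILWitness.isQuarticWitness`: a witness of this crux is a witness of `QuarticGate` (bounded support gives the
  fourth moments), so `Theorems/QuarticGate/Negative/*` transfers.
* §2 `eps_le_level` (`ε ≤ 4π²N²νE`), `dissipation_eq` (`= ∫(u,f)dμ`), `eps_le_force` (`ε ≤ ‖f‖₂√E`),
  `eps_le_radius` (`ε ≤ ‖f‖₂R`, the new clause).
* §2b refuted strengthenings `not_gilBoundedLevel`, `not_gilEveryForce`, `not_gilSubFloor`, `not_gilSmallRadius`;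
  weakenings that hold `gilWithoutEpsPos_holds`, `gilWithoutEnergyCeiling_holds`, `gilFixedViscosity_holds`
  (laminar Kolmogorov Dirac `isGILWitness_dirac_kolState`): every clause of the crux is load-bearing.
-/

namespace Summit.AnomalousDissipation.AnomalousDissipation.Theorems.GalerkinInvariantLoud.Negative

open MeasureTheory Filter Topology
open scoped ENNReal InnerProductSpace RealInnerProductSpace
open Literature.Analysis.FunctionSpaces Literature.Analysis.FluidPDE
open Summit.AnomalousDissipation.AnomalousDissipation.Theses.MomentParity
open Summit.AnomalousDissipation.AnomalousDissipation.Theorems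
open Summit.AnomalousDissipation.AnomalousDissipation.Theorems.QuarticGate.Negative

noncomputable section

-- `T3`, `R3`, `H3`, `L2T3` (torus, values, energy space, `L²`), the level-`N` Galerkin frame `frameG N`
-- and the energy polynomial `energyPoly` are the sibling seat's (CubicParityLoud) abbreviations.
open Summit.AnomalousDissipation.AnomalousDissipation.Theorems.CubicParityLoud.Negative
  (T3 R3 H3 L2T3 frameG energyPoly isBandTest_frameG eval_pderiv_energyPoly polyGrad_energy
   fourierTruncate_ae_eq_of_isLevel eGradNormSq_fourierTruncate_of_isLevel eGradNormSq_lt_top_of_isLevel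
   inertialPairing_fourierTruncate_of_isLevel integral_inner_fourierTruncate_of_isLevel integrable_pairing)

/-! ## §0 Vocabulary: the clauses of the crux, named (verbatim sub-terms of `GalerkinInvariantLoud`) -/

/-- ALL-ORDER polynomial stationarity of `μ` for Galerkin NS at `(ν, f)`, level `N` (the stationarity
clause of `GalerkinInvariantLoud`: every polynomial cylindrical observable with level-`N` band tests is
drift-free — no degree bound). -/
def IsInvariant (ν : ℝ) (f : T3 → R3) (N : ℕ) (μ : Measure H3) : Prop :=
  ∀ (m : ℕ) (g : Fin m → T3 → R3) (P : MvPolynomial (Fin m) ℝ), (∀ i, IsBandTest N (g i)) →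
    Integrable (fun u => Torus.nsGeneratorPairing ν f u (polyGrad g P u)) μ ∧
      ∫ u, Torus.nsGeneratorPairing ν f u (polyGrad g P u) ∂μ = 0

/-- The witness clauses of `GalerkinInvariantLoud` at `(f, ν, N, R, E, ε)`: probability, level-`N`
carried, supported in `‖u‖ ≤ R`, all-order stationary, mean energy `≤ E`, dissipation `≥ ε`. -/
def IsGILWitness (f : T3 → R3) (ν : ℝ) (N : ℕ) (R E ε : ℝ) (μ : Measure H3) : Prop :=
  IsProbabilityMeasure μ ∧ (∀ᵐ u ∂μ, IsLevel N u) ∧ (∀ᵐ u ∂μ, ‖u‖ ≤ R) ∧ IsInvariant ν f N μ ∧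
    Torus.ensembleEnergy μ ≤ E ∧ ε ≤ Torus.ensembleDissipation ν μ

/-- `GalerkinInvariantLoud` restated through the vocabulary (definitional unfolding, `Iff.rfl`). -/
theorem galerkinInvariantLoud_iff :
    GalerkinInvariantLoud ↔ ∃ f : T3 → R3, Torus.IsSmooth f ∧ Torus.IsDivFree f ∧ Torus.HasZeroMean f ∧
      ∃ (ν : ℕ → ℝ) (E ε : ℝ), (∀ j, 0 < ν j) ∧ Tendsto ν atTop (𝓝 0) ∧ 0 < ε ∧
      ∀ j : ℕ, ∃ R : ℝ, ∃ᶠ N in atTop, ∃ μ, IsGILWitness f (ν j) N R E ε μ :=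
  Iff.rfl

/-! ## §1 `GalerkinInvariantLoud ⇒ QuarticGate`: every negative fact about `QuarticGate` witnesses transfers -/

/-- All-order stationarity gives `d`-stationarity for every `d`. -/
theorem IsInvariant.isPolyStationary {ν : ℝ} {f : T3 → R3} {N : ℕ} {μ : Measure H3}
    (h : IsInvariant ν f N μ) (d : ℕ) : IsPolyStationary ν f N d μ :=
  fun m g P hg _ => h m g P hg

/-- All-order stationarity is `d`-stationarity for every `d`. -/
theorem isInvariant_iff_forall {ν : ℝ} {f : T3 → R3} {N : ℕ} {μ : Measure H3} :
    IsInvariant ν f N μ ↔ ∀ d, IsPolyStationary ν f N d μ :=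
  ⟨fun h d => h.isPolyStationary d, fun h m g P hg => h (P.totalDegree + 1) m g P hg le_rfl⟩

/-- A law supported in a ball has moments of every order. -/
theorem integrable_norm_pow_of_ae_le {μ : Measure H3} [IsFiniteMeasure μ] {R : ℝ}
    (hR : ∀ᵐ u ∂μ, ‖u‖ ≤ R) (p : ℕ) : Integrable (fun u : H3 => ‖u‖ ^ p) μ := by
  refine Integrable.mono' (integrable_const (max R 0 ^ p)) (continuous_norm.pow p).aestronglyMeasurable ?_
  filter_upwards [hR] with u hu
  rw [Real.norm_of_nonneg (by positivity)]
  exact pow_le_pow_left₀ (norm_nonneg _) (hu.trans (le_max_left _ _)) p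

/-- **A witness of this crux is a witness of `QuarticGate`** (bounded support gives the fourth moments,
all-order stationarity gives 4-stationarity): every negative fact about `QuarticGate` witnesses transfers. -/
theorem IsGILWitness.isQuarticWitness {f : T3 → R3} {ν : ℝ} {N : ℕ} {R E ε : ℝ} {μ : Measure H3}
    (h : IsGILWitness f ν N R E ε μ) : IsQuarticWitness f ν N E ε μ := by
  obtain ⟨hp, hl, hR, hinv, hE, hε⟩ := h
  exact ⟨hp, hl, integrable_norm_pow_of_ae_le hR 4, hinv.isPolyStationary 4, hE, hε⟩

/-! ## §2 Necessary conditions on witnesses (inherited + the radius floor) and refuted strengthenings -/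

section Necessary

variable {f : T3 → R3} {ν : ℝ} {N : ℕ} {R E ε : ℝ} {μ : Measure H3}

/-- LEVEL CEILING: `ε ≤ 4π²N²νE` (Bernstein; stationarity not used). -/
theorem IsGILWitness.eps_le_level (hν : 0 ≤ ν) (h : IsGILWitness f ν N R E ε μ) :
    ε ≤ 4 * Real.pi ^ 2 * (N : ℝ) ^ 2 * ν * E :=
  h.isQuarticWitness.eps_le hν

/-- ENERGY ROW: the dissipation of a witness IS the mean injected power `∫ (u,f) dμ`. -/
theorem IsGILWitness.dissipation_eq (hf : MemLp f 2 volume) (h : IsGILWitness f ν N R E ε μ) :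
    Torus.ensembleDissipation ν μ = ∫ u, Torus.pairing u.1 f ∂μ := by
  obtain ⟨hp, hl, hR, hinv, -, -⟩ := h
  exact ensembleDissipation_eq_of_polyStationary f hf hl (integrable_norm_pow_of_ae_le hR 2) le_rfl
    (hinv.isPolyStationary 3)

/-- FORCE FLOOR: `ε ≤ ‖f‖₂ √E`. -/
theorem IsGILWitness.eps_le_force (hf : MemLp f 2 volume) (h : IsGILWitness f ν N R E ε μ) :
    ε ≤ Real.sqrt (∫ x, ‖f x‖ ^ 2) * Real.sqrt E :=
  h.isQuarticWitness.eps_le_force hf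

/-- RADIUS FLOOR (new clause of this crux): `ε ≤ ‖f‖₂ R` — the support radius of a witness is at least
`ε/‖f‖₂` (power `∫(u,f)dμ ≤ ‖f‖₂ ∫‖u‖dμ ≤ ‖f‖₂ R`). -/
theorem IsGILWitness.eps_le_radius (hf : MemLp f 2 volume) (h : IsGILWitness f ν N R E ε μ) :
    ε ≤ ‖hf.toLp f‖ * R := by
  have hdiss := h.dissipation_eq hf
  obtain ⟨hp, hl, hR, hinv, -, hε⟩ := h
  have h1 : Integrable (fun u : H3 => ‖u‖) μ := by
    simpa using integrable_norm_pow_of_ae_le hR 1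
  have hpair : ∫ u, Torus.pairing u.1 f ∂μ ≤ ∫ u, ‖hf.toLp f‖ * R ∂μ := by
    refine integral_mono_ae (CubicParityLoud.Negative.integrable_pairing hf h1) (integrable_const _) ?_
    filter_upwards [hR] with u hu
    calc Torus.pairing u.1 f ≤ |Torus.pairing u.1 f| := le_abs_self _
      _ ≤ ‖u‖ * ‖hf.toLp f‖ := Torus.abs_pairing_coe_le hf u
      _ ≤ R * ‖hf.toLp f‖ := mul_le_mul_of_nonneg_right hu (norm_nonneg _)
      _ = ‖hf.toLp f‖ * R := mul_comm _ _
  rw [integral_const, smul_eq_mul, probReal_univ, one_mul] at hpair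
  linarith

end Necessary

/-! ### §2b Refuted natural strengthenings, and the weakenings that hold (the load-bearing table)

Each clause of the crux is necessary for non-triviality: `0 < ε` (W1: `δ₀`), `ensembleEnergy ≤ E` (W2: laminar
Kolmogorov Diracs, `R_j = (4π²ν_j)⁻¹`), `ν_j → 0` (W3: at fixed viscosity the laminar Dirac is loud AND bounded),
`∃ f` (S2: `f = 0` is quiet), `∃ᶠ N` unbounded (S1: a level uniform in `j` is quiet), and the two floors
`‖f‖₂√E ≥ ε` (S3), `‖f‖₂ R ≥ ε` (S4). -/

section Table

/-- The laminar Kolmogorov Dirac `δ_{K_a}`, `a = (4π²ν)⁻¹`, is a witness of ALL clauses of the crux at FIXED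
viscosity, for the force `K_1 = cos(2πx₁)e₀`, at every level `N ≥ 1`: radius `a`, energy `a²/2`, dissipation
`(8π²ν)⁻¹` (exact steady state at every order; sibling file `QuarticGate/Negative/Laminar.lean`). -/
theorem isGILWitness_dirac_kolState {ν : ℝ} (hν : 0 < ν) {N : ℕ} (hN : 1 ≤ N) :
    IsGILWitness (kolField 1) ν N (4 * Real.pi ^ 2 * ν)⁻¹ ((4 * Real.pi ^ 2 * ν)⁻¹ ^ 2 / 2)
      (8 * Real.pi ^ 2 * ν)⁻¹ (Measure.dirac (kolState (4 * Real.pi ^ 2 * ν)⁻¹)) := by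
  haveI : MeasurableSingletonClass H3 := OpensMeasurableSpace.toMeasurableSingletonClass
  obtain ⟨⟨hp, hl, -, -, hE, hD⟩, -⟩ := isQuarticWitness_dirac_kolState hν hN
  set a : ℝ := (4 * Real.pi ^ 2 * ν)⁻¹ with ha
  have ha0 : 0 < a := by positivity
  have hforce : kolField 1 = kolField (4 * Real.pi ^ 2 * ν * a) := by
    rw [ha, mul_inv_cancel₀ (by positivity)]
  refine ⟨hp, hl, ?_, ?_, hE, hD⟩
  · rw [ae_dirac_eq]
    simp only [Filter.eventually_pure]
    have h2 := norm_sq_kolState a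
    nlinarith [norm_nonneg (kolState a)]
  · rw [isInvariant_iff_forall, hforce]
    exact fun d => isPolyStationary_dirac_kolState ν a N d

/-- STRENGTHENING 1 (refuted): the level `N` chosen BEFORE `j` (even only frequently in `j`, any radii). -/
def GILBoundedLevel : Prop :=
  ∃ f : T3 → R3, Torus.IsSmooth f ∧ Torus.IsDivFree f ∧ Torus.HasZeroMean f ∧
    ∃ (ν : ℕ → ℝ) (E ε : ℝ), (∀ j, 0 < ν j) ∧ Tendsto ν atTop (𝓝 0) ∧ 0 < ε ∧
    ∃ N : ℕ, ∃ᶠ j in atTop, ∃ (R : ℝ) (μ : Measure H3), IsGILWitness f (ν j) N R E ε μ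

/-- **`¬ GILBoundedLevel`** (level ceiling `ε ≤ 4π²N²ν_jE → 0`): witnesses live at `N ≳ ν_j^{-1/2}`. -/
theorem not_gilBoundedLevel : ¬ GILBoundedLevel := by
  rintro ⟨f, -, -, -, ν, E, ε, hν, hν0, hε, N, hfreq⟩
  obtain ⟨j, ⟨R, μ, hμ⟩, hno⟩ :=
    (hfreq.and_eventually (eventually_not_isQuarticWitness f hν hν0 E hε N)).exists
  exact hno μ hμ.isQuarticWitness

/-- STRENGTHENING 2 (refuted): the crux for EVERY admissible force. -/
def GILEveryForce : Prop :=
  ∀ f : T3 → R3, Torus.IsSmooth f → Torus.IsDivFree f → Torus.HasZeroMean f →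
    ∃ (ν : ℕ → ℝ) (E ε : ℝ), (∀ j, 0 < ν j) ∧ Tendsto ν atTop (𝓝 0) ∧ 0 < ε ∧
    ∀ j : ℕ, ∃ R : ℝ, ∃ᶠ N in atTop, ∃ μ, IsGILWitness f (ν j) N R E ε μ

/-- **`¬ GILEveryForce`**: `f = 0` is quiet at every order (`ε ≤ ‖0‖₂√E = 0`). The `∃ f` is load-bearing:
a witness force has `‖f‖₂ ≥ ε/√E` (and, Cheskidov 2023 Thm 1.3, the continuum zeroth law is not force-robust). -/
theorem not_gilEveryForce : ¬ GILEveryForce := by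
  intro h
  have hzero : (Torus.realTrigPoly (∅ : Finset (Fin 3 → ℤ)) (0 : (Fin 3 → ℤ) → EuclideanSpace ℂ (Fin 3)))
      = fun _ => 0 := Torus.realTrigPoly_zero ∅
  obtain ⟨ν, E, ε, hν, -, hε, hj⟩ := h (fun _ => 0) (Torus.isSmooth_const _)
    (by rw [← hzero]; exact Torus.isDivFree_realTrigPoly fun k hk => by simp at hk)
    (by simp [Torus.HasZeroMean])
  obtain ⟨R, hR⟩ := hj 0
  obtain ⟨N, μ, hμ⟩ := hR.exists
  have := hμ.eps_le_force (memLp_const 0)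
  simp at this
  linarith

/-- STRENGTHENING 3 (refuted): an energy budget below the force floor, `‖f‖₂ √E < ε`. -/
def GILSubFloor : Prop :=
  ∃ f : T3 → R3, Torus.IsSmooth f ∧ Torus.IsDivFree f ∧ Torus.HasZeroMean f ∧
    ∃ (ν : ℕ → ℝ) (E ε : ℝ), (∀ j, 0 < ν j) ∧ Tendsto ν atTop (𝓝 0) ∧ 0 < ε ∧
    Real.sqrt (∫ x, ‖f x‖ ^ 2) * Real.sqrt E < ε ∧
    ∀ j : ℕ, ∃ R : ℝ, ∃ᶠ N in atTop, ∃ μ, IsGILWitness f (ν j) N R E ε μ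

/-- **`¬ GILSubFloor`** (energy row): every witness has `ε ≤ ‖f‖₂√E`; the laminar family attains it. -/
theorem not_gilSubFloor : ¬ GILSubFloor := by
  rintro ⟨f, hfs, -, -, ν, E, ε, hν, -, hε, hlt, hj⟩
  obtain ⟨R, hR⟩ := hj 0
  obtain ⟨N, μ, hμ⟩ := hR.exists
  have := hμ.eps_le_force (hfs.memLp 2)
  linarith

/-- STRENGTHENING 4 (refuted; the new clause): support radii below the radius floor, `‖f‖₂ R_j < ε`. -/
def GILSmallRadius : Prop :=
  ∃ f : T3 → R3, Torus.IsSmooth f ∧ Torus.IsDivFree f ∧ Torus.HasZeroMean f ∧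
    ∃ (ν : ℕ → ℝ) (E ε : ℝ), (∀ j, 0 < ν j) ∧ Tendsto ν atTop (𝓝 0) ∧ 0 < ε ∧
    ∀ j : ℕ, ∃ R : ℝ, Real.sqrt (∫ x, ‖f x‖ ^ 2) * R < ε ∧
      ∃ᶠ N in atTop, ∃ μ, IsGILWitness f (ν j) N R E ε μ

/-- **`¬ GILSmallRadius`**: `ε ≤ ‖f‖₂ R` for every witness (power `≤ ‖f‖₂ ∫‖u‖ ≤ ‖f‖₂ R`). -/
theorem not_gilSmallRadius : ¬ GILSmallRadius := by
  rintro ⟨f, hfs, -, -, ν, E, ε, hν, -, hε, hj⟩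
  obtain ⟨R, hlt, hR⟩ := hj 0
  obtain ⟨N, μ, hμ⟩ := hR.exists
  have h := hμ.eps_le_radius (hfs.memLp 2)
  rw [CubicParityLoud.Negative.norm_toLp_eq_sqrt] at h
  linarith

/-- WEAKENING 1 (holds trivially): the crux without `0 < ε`. -/
def GILWithoutEpsPos : Prop :=
  ∃ f : T3 → R3, Torus.IsSmooth f ∧ Torus.IsDivFree f ∧ Torus.HasZeroMean f ∧
    ∃ (ν : ℕ → ℝ) (E ε : ℝ), (∀ j, 0 < ν j) ∧ Tendsto ν atTop (𝓝 0) ∧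
    ∀ j : ℕ, ∃ R : ℝ, ∃ᶠ N in atTop, ∃ μ, IsGILWitness f (ν j) N R E ε μ

/-- `δ₀` with `f = 0` satisfies every clause with `R = E = ε = 0`. -/
theorem isGILWitness_dirac_zero (ν : ℝ) (hν : 0 ≤ ν) (N : ℕ) :
    IsGILWitness (fun _ => 0) ν N 0 0 0 (Measure.dirac (0 : H3)) := by
  haveI : MeasurableSingletonClass H3 := OpensMeasurableSpace.toMeasurableSingletonClass
  refine ⟨inferInstance, ?_, ?_, ?_, ?_, ?_⟩
  · rw [ae_dirac_eq]
    simp only [Filter.eventually_pure]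
    intro k _
    exact mFourierCoeff_coe_zero k
  · rw [ae_dirac_eq]
    simp
  · intro m g P _
    refine ⟨Torus.integrable_dirac _ _, ?_⟩
    rw [integral_dirac]
    exact nsGeneratorPairing_zero_zero ν _
  · simp [Torus.ensembleEnergy, integral_dirac]
  · exact mul_nonneg hν ENNReal.toReal_nonneg

/-- **`0 < ε` is load-bearing** (`ν_j = 1/(j+1)`, `f = 0`, `δ₀`). -/
theorem gilWithoutEpsPos_holds : GILWithoutEpsPos := by
  have hzero : (Torus.realTrigPoly (∅ : Finset (Fin 3 → ℤ)) (0 : (Fin 3 → ℤ) → EuclideanSpace ℂ (Fin 3)))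
      = fun _ => 0 := Torus.realTrigPoly_zero ∅
  refine ⟨fun _ => 0, Torus.isSmooth_const _, ?_, ?_, fun j => 1 / ((j : ℝ) + 1), 0, 0,
    fun j => by positivity, tendsto_one_div_add_atTop_nhds_zero_nat, fun j => ⟨0, ?_⟩⟩
  · rw [← hzero]
    exact Torus.isDivFree_realTrigPoly fun k hk => by simp at hk
  · simp [Torus.HasZeroMean]
  · exact Frequently.of_forall fun N => ⟨_, isGILWitness_dirac_zero _ (by positivity) N⟩

/-- WEAKENING 2 (holds): the crux without the energy ceiling `ensembleEnergy μ ≤ E` (radius kept, `R` per `j`). -/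
def GILWithoutEnergyCeiling : Prop :=
  ∃ f : T3 → R3, Torus.IsSmooth f ∧ Torus.IsDivFree f ∧ Torus.HasZeroMean f ∧
    ∃ (ν : ℕ → ℝ) (ε : ℝ), (∀ j, 0 < ν j) ∧ Tendsto ν atTop (𝓝 0) ∧ 0 < ε ∧
    ∀ j : ℕ, ∃ R : ℝ, ∃ᶠ N in atTop, ∃ μ : Measure H3,
      IsProbabilityMeasure μ ∧ (∀ᵐ u ∂μ, IsLevel N u) ∧ (∀ᵐ u ∂μ, ‖u‖ ≤ R) ∧ IsInvariant (ν j) f N μ ∧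
        ε ≤ Torus.ensembleDissipation (ν j) μ

/-- **The energy ceiling is load-bearing**: the laminar Kolmogorov Diracs `δ_{K_1/(4π²ν_j)}` (radius
`R_j = (4π²ν_j)⁻¹`, which the crux allows to depend on `j`) witness everything else, dissipation `(8π²ν_j)⁻¹ ≥ (8π²)⁻¹`. -/
theorem gilWithoutEnergyCeiling_holds : GILWithoutEnergyCeiling := by
  have hpi : 0 < Real.pi := Real.pi_pos
  refine ⟨kolField 1, isSmooth_kolField 1, isDivFree_kolField 1, hasZeroMean_kolField 1,
    fun j => 1 / ((j : ℝ) + 1), (8 * Real.pi ^ 2)⁻¹, fun j => by positivity,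
    tendsto_one_div_add_atTop_nhds_zero_nat, by positivity, fun j => ⟨(4 * Real.pi ^ 2 * (1 / ((j : ℝ) + 1)))⁻¹, ?_⟩⟩
  refine (eventually_ge_atTop 1).frequently.mono fun N hN => ?_
  set ν : ℝ := 1 / ((j : ℝ) + 1) with hν
  have hν0 : 0 < ν := by positivity
  have hν1 : ν ≤ 1 := by
    rw [hν, div_le_one (by positivity)]; linarith [(Nat.cast_nonneg j : (0 : ℝ) ≤ j)]
  obtain ⟨hp, hl, hR, hinv, -, hD⟩ := isGILWitness_dirac_kolState hν0 hN
  refine ⟨_, hp, hl, hR, hinv, le_trans ?_ hD⟩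
  exact inv_anti₀ (by positivity) (by nlinarith [hν1, hpi])

/-- WEAKENING 3 (holds): the crux without `ν_j → 0` (everything else kept, incl. the energy ceiling). -/
def GILFixedViscosity : Prop :=
  ∃ f : T3 → R3, Torus.IsSmooth f ∧ Torus.IsDivFree f ∧ Torus.HasZeroMean f ∧
    ∃ (ν : ℕ → ℝ) (E ε : ℝ), (∀ j, 0 < ν j) ∧ 0 < ε ∧
    ∀ j : ℕ, ∃ R : ℝ, ∃ᶠ N in atTop, ∃ μ, IsGILWitness f (ν j) N R E ε μ

/-- **`ν_j → 0` is load-bearing**: at fixed viscosity `ν ≡ 1` the laminar Dirac is a loud, bounded-energy,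
compactly supported, all-order invariant level-1 law (`E = (4π²)⁻²/2`, `ε = (8π²)⁻¹`). -/
theorem gilFixedViscosity_holds : GILFixedViscosity := by
  refine ⟨kolField 1, isSmooth_kolField 1, isDivFree_kolField 1, hasZeroMean_kolField 1, fun _ => 1,
    ((4 * Real.pi ^ 2 * 1)⁻¹) ^ 2 / 2, (8 * Real.pi ^ 2 * 1)⁻¹, fun _ => one_pos, by positivity, fun j => ?_⟩
  exact ⟨(4 * Real.pi ^ 2 * 1)⁻¹, (eventually_ge_atTop 1).frequently.mono fun N hN =>
    ⟨_, isGILWitness_dirac_kolState one_pos hN⟩⟩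

end Table


end

end Summit.AnomalousDissipation.AnomalousDissipation.Theorems.GalerkinInvariantLoud.Negative
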